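import Summits.CriticalPhenomena.PercolationContinuityZ3.Theorems.Transplant.BoxProdZ2TubeLevels
import HarnessLib

/-!
# Fibre-GROWING product levels of `X □ ℤ²` (Kozma–Nitzan's `B⟨j⟩` for the product, version (B) of P5 §13): the levels
# `B⟨j⟩ = B_X(β, ρ + j) × Icc (lo - j) (hi + j)` grow by one step in the fibre AND in the plane, so that their outer vertex boundary IN
# `X □ ℤ²` ITSELF lies in the next level — no tube graph, no fibre window, hence no window-edge contacts (HOME/prim-bschramm-p2-g2/EDGE-CONTACTS.md)

builds on p205010 (kernel theorem, internal audit signed; external expert review pending) — nothing in this file uses p205010.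
Lane `prim-bschramm`, seat `prim-bschramm-p2` (Corridor-over-levels; instance-side but kit-independent); helper file
(`--supports stmt-CriticalPhenomena-4575`).

* `prodLevel X β ρ lo hi j`, `mem_prodLevel_iff`, `prodLevel_zero`, `prodLevel_monotone`, **`prodLevel_nest`** (outer boundary in `X □ ℤ²` of
  level `j` ⊆ level `j+1`: a fibre edge raises the fibre distance by one, a planar edge the planar one);
* `prodLData`, `reachB_prodLData`, **`lhyp_prod`** (`KNLevels.LHyp` in `G = X □ ℤ²` from a subbox `D ⊇ B⟨R+1⟩` of a finitely supported
  weighting and a source off `D`), **`stepII_prod`** (Step II with degree bound `Δ + 4`).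
The contacts of these levels are of two kinds — MACRO (fibre inside the ball, planar neighbour outside the box) and FIBRE-FACING (fibre at distance
`ρ + j + 1`, planar inside) — both inside any product region containing `B⟨j+1⟩`, so every contact can carry a kit (p3-g2: macro kits as in
`BoxProdZ2SeedKit`, fibre-facing kits with the cube clamped inward along a fibre geodesic).
[cite: KozmaNitzan2024, §4 p. 15 (B⟨R⟩), Lemma 10 (p. 17), p. 18 (Step II)] [cite: GrimmettPercolation1999, §7.2]
-/

noncomputable section

open MeasureTheory ProbabilityTheory
open scoped ENNReal

namespace Summit.CriticalPhenomena.PercolationContinuityZ3.Theorems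

namespace Transplant

namespace BoxProdZ2

open Literature.Probability.Percolation Literature.Probability.LatticeModels SimpleGraph
open KNLevels

variable {W : Type*} [DecidableEq W] (X : SimpleGraph W) [X.LocallyFinite]

/-! ## §1 The levels -/

/-- **The fibre-growing product level** `B⟨j⟩ = B_X(β, ρ + j) × Icc (lo - j) (hi + j)`. [cite: KozmaNitzan2024, §4 p. 15 (B⟨R⟩)] -/
def prodLevel (β : W) (ρ : ℕ) (lo hi : Site 2) (j : ℕ) : Finset (W × Site 2) :=
  ballFin X β (ρ + j) ×ˢ Finset.Icc (lo - (j : Site 2)) (hi + (j : Site 2))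

omit [DecidableEq W] in
/-- Membership in a product level. [folklore] -/
theorem mem_prodLevel_iff {β : W} {ρ : ℕ} {lo hi : Site 2} {j : ℕ} {v : W × Site 2} :
    v ∈ prodLevel X β ρ lo hi j ↔ v.1 ∈ ballFin X β (ρ + j) ∧ v.2 ∈ Finset.Icc (lo - (j : Site 2)) (hi + (j : Site 2)) := by
  rw [prodLevel, Finset.mem_product]

omit [DecidableEq W] in
/-- Level `0` is `B_X(β, ρ) × Icc lo hi`. [folklore] -/
theorem prodLevel_zero (β : W) (ρ : ℕ) (lo hi : Site 2) : prodLevel X β ρ lo hi 0 = ballFin X β ρ ×ˢ Finset.Icc lo hi := by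
  simp [prodLevel]

omit [DecidableEq W] in
/-- **Level axiom 1**: the product levels increase. [folklore] -/
theorem prodLevel_monotone (β : W) (ρ : ℕ) (lo hi : Site 2) : Monotone (prodLevel X β ρ lo hi) := by
  intro j j' h
  refine Finset.product_subset_product (ballFin_mono X β (by omega)) (Finset.Icc_subset_Icc (fun i => ?_) (fun i => ?_)) <;>
    simp only [Pi.sub_apply, Pi.add_apply, Pi.natCast_apply] <;> omega

omit [DecidableEq W] in
/-- A neighbour of a point of `B_X(x, n)` lies in `B_X(x, n+1)`. [folklore] -/
theorem mem_ballFin_succ_of_adj {x v u : W} {n : ℕ} (hv : v ∈ ballFin X x n) (h : X.Adj v u) : u ∈ ballFin X x (n + 1) := by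
  rw [mem_ballFin] at hv ⊢
  obtain ⟨w, hw⟩ := hv
  exact ⟨w.append (SimpleGraph.Walk.cons h SimpleGraph.Walk.nil),
    by rw [SimpleGraph.Walk.length_append, SimpleGraph.Walk.length_cons, SimpleGraph.Walk.length_nil]; omega⟩

/-- **Level axiom 2 in `X □ ℤ²` itself**: the outer vertex boundary of `B⟨j⟩` lies in `B⟨j+1⟩`. [cite: KozmaNitzan2024, §4 p. 15 (∂_ev B ⊆ B⟨1⟩)] -/
theorem prodLevel_nest (β : W) (ρ : ℕ) (lo hi : Site 2) (j : ℕ) :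
    outerBoundary (X □ zdGraph 2) (prodLevel X β ρ lo hi j) ⊆ prodLevel X β ρ lo hi (j + 1) := by
  intro x hx
  rw [mem_outerBoundary_iff] at hx
  obtain ⟨hxn, y, hy, hxy⟩ := hx
  rw [mem_prodLevel_iff] at hy ⊢
  have hIcc : Finset.Icc (lo - (j : Site 2)) (hi + (j : Site 2)) ⊆ Finset.Icc (lo - ((j + 1 : ℕ) : Site 2)) (hi + ((j + 1 : ℕ) : Site 2)) :=
    Finset.Icc_subset_Icc (fun i => by simp only [Pi.sub_apply, Pi.natCast_apply]; push_cast; omega)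
      (fun i => by simp only [Pi.add_apply, Pi.natCast_apply]; push_cast; omega)
  rcases SimpleGraph.boxProd_adj.1 hxy with ⟨h1, h2⟩ | ⟨h1, h2⟩
  · -- a fibre edge: the fibre distance grows by one, the planar coordinate is unchanged
    refine ⟨?_, hIcc (h2 ▸ hy.2)⟩
    have := mem_ballFin_succ_of_adj X hy.1 h1.symm
    simpa [Nat.add_assoc] using this
  · -- a planar edge: `x.2` is a planar outer-boundary point of the box
    have hx1 : x.1 ∈ ballFin X β (ρ + j) := h2 ▸ hy.1
    refine ⟨ballFin_mono X β (by omega) hx1, ?_⟩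
    have hx2 : x.2 ∉ Finset.Icc (lo - (j : Site 2)) (hi + (j : Site 2)) := fun h =>
      hxn ((mem_prodLevel_iff X).2 ⟨hx1, h⟩)
    have hob : x.2 ∈ outerBoundary (zdGraph 2) (Finset.Icc (lo - (j : Site 2)) (hi + (j : Site 2))) :=
      mem_outerBoundary_iff.2 ⟨hx2, y.2, hy.2, h1⟩
    have h := KozmaNitzan.mem_Icc_enlarge_one_of_mem_outerBoundary hob
    refine Finset.Icc_subset_Icc (fun i => ?_) (fun i => ?_) h <;>
      simp only [Pi.sub_apply, Pi.add_apply, Pi.natCast_apply, Pi.one_apply] <;> push_cast <;> omega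

/-! ## §2 The level data, the hypotheses of Lemma 10, Step II -/

/-- **The product level data in `X □ ℤ²`**. [cite: KozmaNitzan2024, §4 Lemma 10 (p. 17)] -/
def prodLData (β : W) (ρ : ℕ) (lo hi : Site 2) (o : W × Site 2) (Sfin : Finset (W × Site 2)) : LData (X □ zdGraph 2) :=
  ⟨prodLevel X β ρ lo hi, o, Sfin⟩

omit [DecidableEq W] in
/-- The levels of `prodLData`. [folklore] -/
@[simp] theorem prodLData_X (β : W) (ρ : ℕ) (lo hi : Site 2) (o : W × Site 2) (Sfin : Finset (W × Site 2)) :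
    (prodLData X β ρ lo hi o Sfin).X = prodLevel X β ρ lo hi := rfl

omit [DecidableEq W] in
/-- The source of `prodLData`. [folklore] -/
@[simp] theorem prodLData_o (β : W) (ρ : ℕ) (lo hi : Site 2) (o : W × Site 2) (Sfin : Finset (W × Site 2)) :
    (prodLData X β ρ lo hi o Sfin).o = o := rfl

omit [DecidableEq W] in
/-- The support of `prodLData`. [folklore] -/
@[simp] theorem prodLData_Sfin (β : W) (ρ : ℕ) (lo hi : Site 2) (o : W × Site 2) (Sfin : Finset (W × Site 2)) :
    (prodLData X β ρ lo hi o Sfin).Sfin = Sfin := rfl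

omit [DecidableEq W] in
/-- `{o ↔ B}` for the product data is `{o ↔ B_X(β, ρ) × Icc lo hi}`. [folklore] -/
theorem reachB_prodLData (β : W) (ρ : ℕ) (lo hi : Site 2) (o : W × Site 2) (Sfin : Finset (W × Site 2)) :
    (prodLData X β ρ lo hi o Sfin).reachB = ⋃ b ∈ ballFin X β ρ ×ˢ Finset.Icc lo hi, openConn o b := by
  rw [LData.reachB, prodLData_X, prodLevel_zero]; rfl

/-- **The hypotheses of Lemma 10 for the product levels in `X □ ℤ²`.** [cite: KozmaNitzan2024, §4 Lemma 10 (p. 17)] -/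
theorem lhyp_prod (β : W) (ρ : ℕ) (lo hi : Site 2) {o : W × Site 2} {Sfin D : Finset (W × Site 2)}
    {Wt : Sym2 (W × Site 2) → unitInterval} {p : unitInterval} {R : ℕ}
    (hsub : IsSubbox (X □ zdGraph 2) Wt p D) (hfin : FinSupp Wt Sfin) (hDS : D ⊆ Sfin)
    (hencl : prodLevel X β ρ lo hi (R + 1) ⊆ D) (ho : o ∉ D) (hoS : o ∈ Sfin) :
    LHyp (prodLData X β ρ lo hi o Sfin) Wt p D R where
  mono := prodLevel_monotone X β ρ lo hi
  nest := prodLevel_nest X β ρ lo hi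
  sub := hsub
  fin := hfin
  DS := hDS
  encl := hencl
  o_not := ho
  o_mem := hoS

/-- **Kozma–Nitzan's Step II over the product levels of `X □ ℤ²`** (degrees `≤ Δ + 4`). [cite: KozmaNitzan2024, §4 p. 18 (Step II)] -/
theorem stepII_prod [Countable W] {Δ : ℕ} (hΔ : ∀ w, X.degree w ≤ Δ)
    (β : W) (ρ : ℕ) (lo hi : Site 2) {o : W × Site 2} {Sfin D : Finset (W × Site 2)}
    {Wt : Sym2 (W × Site 2) → unitInterval} {p : unitInterval} {R : ℕ}
    (hsub : IsSubbox (X □ zdGraph 2) Wt p D) (hfin : FinSupp Wt Sfin) (hDS : D ⊆ Sfin)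
    (hencl : prodLevel X β ρ lo hi (R + 1) ⊆ D) (ho : o ∉ D) (hoS : o ∈ Sfin)
    (hp1 : (p : ℝ) < 1) {N j₀ j₁ : ℕ} (hj₁ : j₁ ≤ R) {δ : ℝ}
    (hJ : 1 / (1 - (p : ℝ)) ^ ((Δ + 4) * N) ≤ δ * ((Finset.Icc j₀ j₁).card : ℝ))
    (hreach : 1 - δ < (prodBernoulli Wt).real (⋃ b ∈ ballFin X β ρ ×ˢ Finset.Icc lo hi, openConn o b)) :
    ∃ j ∈ Finset.Icc j₀ j₁, 1 - 2 * δ < (prodBernoulli Wt).real {ω | N ≤ ((prodLData X β ρ lo hi o Sfin).Kont j ω).card} := by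
  have hL := lhyp_prod X β ρ lo hi hsub hfin hDS hencl ho hoS
  rw [← reachB_prodLData X β ρ lo hi o Sfin] at hreach
  exact hL.stepII (ProdKN.degree_prod_le X hΔ) hp1 hj₁ hJ hreach

end BoxProdZ2

end Transplant

end Summit.CriticalPhenomena.PercolationContinuityZ3.Theorems

end
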